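import Literature.AnabelianGeometry.SemiGraphs.TemperedBranchDoubleFold
import Literature.AnabelianGeometry.SemiGraphs.TemperedVerticialInjective
import HarnessLib

/-!
# The TWIST functors of the double of a semi-graph of anabelioids along a branch

Mochizuki, *Semi-graphs of anabelioids*, Publ. RIMS **42** (2006), §2 Rmk. 2.4.2 p. 26 (the 2-cells:
branch homomorphisms compatible "up to conjugation"), §3 Prop. 3.2 p. 35, Def. 3.5 p. 37, Prop. 3.6 (iv)
p. 39, Cor. 3.9 proof p. 43 l. 13 ("`φ` arises from a morphism of graphs of anabelioids")
[cite: MochizukiSemiAnbd2006, Cor 3.9 p.43].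

Toolkit of the abc-iut cell (layer L3, F wave seat abc-iut-f-175), sequel of `TemperedBranchDoubleFold.lean`,
for the CHOSEN-CONJUGATOR reading of "induced" (the tree's frozen `Hom.Induces`, step (R3)
`InducesOfCompatible` of `TemperedReconstructionReductions.lean`; cell obstruction O-Cor39-1 / finding
d080-F2 / ruling ξ2: "the one-branch twist makes the chosen-conjugator pull-back non-canonical").  For the
double `D` of `𝒢` along the branch `b` at `w` and a family `ε` of elements of `Π_w` CENTRALISING `b_*(Π_e)`,
one per branch of `D`:

* `ProfiniteSemiGraph.twistCov h ε hε : B^cov(D) ⥤ B^cov(D)` — the TWIST functor: same constituents, the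
  gluing along the branch `β` followed by the action of `ε β` (an automorphism of `b^* S_v` because `ε β`
  centralises `b_*(Π_e)`); it fixes both restriction functors ON THE NOSE, so it preserves finite limits,
  countable colimits and tempered objects (`twistBTemp`), and through a chart it is a morphism of connected
  temperoids (`twistTemperoidHom`) represented — Proposition 3.2, `TemperoidHomEqRes_holds` — by a
  continuous `τ : π₁^temp(D) → π₁^temp(D)` (`exists_twistHom`) with `τ ∘ ψ` conjugate to `ψ` for every
  verticial and every edge homomorphism `ψ` of `D` (`twist_conj_verticial`, `twist_conj_edge`): `τ` is
  COMPATIBLE WITH THE IDENTITY morphism of `D` on verticial and edge homomorphisms;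
* `ProfiniteSemiGraph.Hom.idHom 𝒢` — the identity morphism of a semi-graph of anabelioids in the local
  presentation (conjugators `g = 1`), locally open.

Consumer: the refutation of the chosen-conjugator step (R3) `InducesOfCompatible` at the double of the
estranged Iwahori loop.  Nothing here takes a side on [IUTchIII] Cor. 3.12; no statement of the paper is
asserted.
-/

noncomputable section

open CategoryTheory CategoryTheory.Limits Topology

namespace Literature.AnabelianGeometry.SemiGraphs

open Literature.AlgebraicGeometry.Frobenioids.QuasiTemperoid (BTempConnected.ρ_mul_apply
  BTempConnected.ρ_inv_apply BTempConnected.ρ_apply_inv BTempConnected.hom_ρ BTempConnected.hom_ext_apply)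

universe u

namespace ProfiniteSemiGraph

/-! ### The identity morphism of a semi-graph of anabelioids -/

/-- The identity morphism of `𝒢` in the local presentation: identities on the underlying semi-graph and
on all constituent groups, conjugators `g = 1` (Rmk. 2.4.2). [cite: MochizukiSemiAnbd2006, Rmk 2.4.2 p.26] -/
def Hom.idHom (𝒢 : ProfiniteSemiGraph.{u}) : Hom 𝒢 𝒢 where
  base := SemiGraph.Hom.id _
  hV _ := ContinuousMonoidHom.id _
  hE _ := ContinuousMonoidHom.id _
  comm _ _ _ := ⟨1, fun x => by rw [one_mul, inv_one, mul_one]; rfl⟩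

/-- The identity morphism is locally open (its images are everything).
[cite: MochizukiSemiAnbd2006, Def 2.2(ii) p.24] -/
theorem Hom.idHom_isLocallyOpen (𝒢 : ProfiniteSemiGraph.{u}) : (Hom.idHom 𝒢).IsLocallyOpen := by
  constructor
  · intro v
    have : ((Hom.idHom 𝒢).hV v).toMonoidHom.range = ⊤ := MonoidHom.range_eq_top.2 fun x => ⟨x, rfl⟩
    rw [this]; exact isOpen_univ
  · intro e
    have : ((Hom.idHom 𝒢).hE e).toMonoidHom.range = ⊤ := MonoidHom.range_eq_top.2 fun x => ⟨x, rfl⟩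
    rw [this]; exact isOpen_univ

/-! ### The action of a centralising element as an automorphism of `b^* X` -/

section ActIso

variable {Γ Λ : Type u} [Group Γ] [TopologicalSpace Γ] [Group Λ] [TopologicalSpace Λ]
  (f : Λ →ₜ* Γ) (z : Γ) (hz : ∀ x, z * f x = f x * z)

/-- For `z ∈ Γ` centralising the image of `f : Λ → Γ`, the action of `z` on a `Γ`-object `X` is an
automorphism of the `Λ`-object `f^* X` (Rmk. 2.4.2: the 2-cells of a morphism of semi-graphs of anabelioids
are such centralising elements). [cite: MochizukiSemiAnbd2006, Rmk 2.4.2 p.26] -/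
def actIso (X : BTemp Γ) : (BTemp.res f).obj X ≅ (BTemp.res f).obj X :=
  BTemp.isoOfEquiv
    { toFun := X.obj.ρ z
      invFun := X.obj.ρ z⁻¹
      left_inv := fun x => BTempConnected.ρ_inv_apply X z x
      right_inv := fun x => BTempConnected.ρ_apply_inv X z x }
    (fun g x => by
      change X.obj.ρ z (X.obj.ρ (f g) x) = X.obj.ρ (f g) (X.obj.ρ z x)
      rw [← BTempConnected.ρ_mul_apply, ← BTempConnected.ρ_mul_apply, hz])

/-- The underlying function of `actIso` is the action of `z`. [cite: MochizukiSemiAnbd2006, Rmk 2.4.2 p.26] -/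
@[simp] theorem actIso_hom_apply (X : BTemp Γ) (x : X.obj.V) :
    ((actIso f z hz X).hom.hom.hom x : X.obj.V) = X.obj.ρ z x := rfl

/-- `actIso` is natural in `X`. [cite: MochizukiSemiAnbd2006, Rmk 2.4.2 p.26] -/
theorem actIso_naturality {X Y : BTemp Γ} (φ : X ⟶ Y) :
    (BTemp.res f).map φ ≫ (actIso f z hz Y).hom = (actIso f z hz X).hom ≫ (BTemp.res f).map φ := by
  apply BTempConnected.hom_ext_apply
  intro x
  change Y.obj.ρ z (φ.hom.hom x) = φ.hom.hom (X.obj.ρ z x)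
  rw [BTempConnected.hom_ρ]

end ActIso

variable {𝒢 : ProfiniteSemiGraph.{u}} {b : 𝒢.graph.Branch} {w : 𝒢.graph.Vertex}
  (h : 𝒢.graph.abuts b = some w) (ε : (𝒢.double h).graph.Branch → 𝒢.Gv w)
  (hε : ∀ β x, ε β * 𝒢.brHom b w h x = 𝒢.brHom b w h x * ε β)

/-! ### The twist functor `B^cov(D) ⥤ B^cov(D)` -/

/-- The twist of an object of `B^cov(D)`: same constituents, the gluing along `β` followed by the action
of `ε β`. [cite: MochizukiSemiAnbd2006, Rmk 2.4.2 p.26] -/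
def twistObj (S : CovObj (𝒢.double h)) : CovObj (𝒢.double h) where
  SV := S.SV
  SE := S.SE
  glue β v hv := S.glue β v hv ≪≫ actIso (𝒢.brHom b w h) (ε β) (hε β) (S.SV v)

/-- The twist of a morphism: the same components. [cite: MochizukiSemiAnbd2006, §3 p.36] -/
def twistMap {S T : CovObj (𝒢.double h)} (f : S ⟶ T) : twistObj h ε hε S ⟶ twistObj h ε hε T where
  fV := f.fV
  fE := f.fE
  comm β v hv := by
    have h1 := f.comm β v hv
    have h2 := actIso_naturality (𝒢.brHom b w h) (ε β) (hε β) (X := S.SV v) (Y := T.SV v) (f.fV v)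
    change f.fE _ ≫ (T.glue β v hv).hom ≫ (actIso _ _ _ _).hom =
      ((S.glue β v hv).hom ≫ (actIso _ _ _ _).hom) ≫ _
    rw [← Category.assoc, h1, Category.assoc, Category.assoc]
    exact congrArg (fun t => (S.glue β v hv).hom ≫ t) h2

/-- **The TWIST functor** of `B^cov(D)` by the centralising family `ε` (the functor form of the chosen-
conjugator ambiguity of Rmk. 2.4.2 / cell obstruction O-Cor39-1). [cite: MochizukiSemiAnbd2006, Rmk 2.4.2 p.26] -/
def twistCov : CovObj (𝒢.double h) ⥤ CovObj (𝒢.double h) where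
  obj := twistObj h ε hε
  map := twistMap h ε hε
  map_id S := by refine CovHom.ext ?_ ?_ <;> rfl
  map_comp f g := by refine CovHom.ext ?_ ?_ <;> rfl

/-- Twist then restrict to a vertex = restrict (definitional). [cite: MochizukiSemiAnbd2006, Def 3.5(ii) p.37] -/
theorem twistCov_comp_restrictV (v : (𝒢.double h).graph.Vertex) :
    twistCov h ε hε ⋙ restrictV (𝒢.double h) v = restrictV (𝒢.double h) v := rfl

/-- Twist then restrict to the edge = restrict (definitional). [cite: MochizukiSemiAnbd2006, Def 3.5(ii) p.37] -/
theorem twistCov_comp_restrictE (e : (𝒢.double h).graph.Edge) :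
    twistCov h ε hε ⋙ restrictE (𝒢.double h) e = restrictE (𝒢.double h) e := rfl

/-- The twist functor preserves finite limits (detected fibre by fibre). [cite: MochizukiSemiAnbd2006, §3 p.36] -/
theorem preservesLimitsOfShape_twistCov (J : Type) [SmallCategory J] [FinCategory J] :
    PreservesLimitsOfShape J (twistCov h ε hε) := by
  haveI : ∀ v, PreservesLimitsOfShape J (restrictV (𝒢.double h) v) :=
    fun v => CovObj.preservesLimitsOfShape_restrictV _ v
  haveI : ∀ e, PreservesLimitsOfShape J (restrictE (𝒢.double h) e) :=
    fun e => CovObj.preservesLimitsOfShape_restrictE _ e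
  refine ⟨fun {K} => ⟨fun {c} hc => CovObj.isLimitOfComponents _ (fun v => ?_) (fun e => ?_)⟩⟩
  · change IsLimit ((twistCov h ε hε ⋙ restrictV (𝒢.double h) v).mapCone c)
    rw [twistCov_comp_restrictV h ε hε v]
    exact isLimitOfPreserves _ hc
  · change IsLimit ((twistCov h ε hε ⋙ restrictE (𝒢.double h) e).mapCone c)
    rw [twistCov_comp_restrictE h ε hε e]
    exact isLimitOfPreserves _ hc

/-- The twist functor preserves countable colimits (detected fibre by fibre). [cite: MochizukiSemiAnbd2006, §3 p.36] -/
theorem preservesColimitsOfShape_twistCov (J : Type) [SmallCategory J] [CountableCategory J] :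
    PreservesColimitsOfShape J (twistCov h ε hε) := by
  haveI : ∀ v, PreservesColimitsOfShape J (restrictV (𝒢.double h) v) :=
    fun v => CovObj.preservesColimitsOfShape_restrictV _ v
  haveI : ∀ e, PreservesColimitsOfShape J (restrictE (𝒢.double h) e) :=
    fun e => CovObj.preservesColimitsOfShape_restrictE _ e
  refine ⟨fun {K} => ⟨fun {c} hc => CovObj.isColimitOfComponents _ (fun v => ?_) (fun e => ?_)⟩⟩
  · change IsColimit ((twistCov h ε hε ⋙ restrictV (𝒢.double h) v).mapCocone c)
    rw [twistCov_comp_restrictV h ε hε v]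
    exact isColimitOfPreserves _ hc
  · change IsColimit ((twistCov h ε hε ⋙ restrictE (𝒢.double h) e).mapCocone c)
    rw [twistCov_comp_restrictE h ε hε e]
    exact isColimitOfPreserves _ hc

/-! ### The twist preserves tempered objects -/

/-- Points of the twist of `S` in one connected component are points of `S` in one connected component
(the twisted gluing differs from the gluing by the action of `ε β ∈ Π_v`).
[cite: MochizukiSemiAnbd2006, Def 3.5(ii) p.37] -/
theorem sameComponent_twist (S : CovObj (𝒢.double h)) {p q : ((twistCov h ε hε).obj S).Point}
    (hpq : ((twistCov h ε hε).obj S).SameComponent p q) : S.SameComponent p q := by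
  induction hpq with
  | rel a c hac =>
    cases hac with
    | vertex v g x => exact Relation.EqvGen.rel _ _ (CovObj.Adj.vertex (S := S) v g x)
    | edge e g x => exact Relation.EqvGen.rel _ _ (CovObj.Adj.edge (S := S) e g x)
    | glue β v hv x =>
      exact Relation.EqvGen.trans _ _ _ (Relation.EqvGen.rel _ _ (CovObj.Adj.glue (S := S) β v hv x))
        (Relation.EqvGen.rel _ _ (CovObj.Adj.vertex (S := S) v (ε β) ((S.glue β v hv).hom.hom.hom x)))
  | refl a => exact Relation.EqvGen.refl _
  | symm a c _ ih => exact Relation.EqvGen.symm _ _ ih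
  | trans a c d _ _ ih₁ ih₂ => exact Relation.EqvGen.trans _ _ _ ih₁ ih₂

/-- **The twist preserves tempered objects** (Def. 3.5 (ii)): the splitting finite object of `S` splits
the twist of `S` (splitting only involves the actions, which are unchanged).
[cite: MochizukiSemiAnbd2006, Def 3.5(ii) p.37] -/
theorem isTempered_twistCov {S : CovObj (𝒢.double h)} (hS : S.IsTempered) :
    ((twistCov h ε hε).obj S).IsTempered := by
  intro p
  obtain ⟨T, hTfin, hTne, hsplit⟩ := hS p
  refine ⟨T, hTfin, hTne, fun q hpq => ?_⟩
  have hq := hsplit q (sameComponent_twist h ε hε S hpq)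
  rcases q with ⟨v, s⟩ | ⟨e, s⟩
  · exact hq
  · exact hq

/-- The twist functor on tempered objects `B^temp(D) ⥤ B^temp(D)`. [cite: MochizukiSemiAnbd2006, Def 3.5(ii) p.37] -/
def twistBTemp : BTempCat (𝒢.double h) ⥤ BTempCat (𝒢.double h) :=
  ObjectProperty.lift _ (ObjectProperty.ι _ ⋙ twistCov h ε hε) fun S => isTempered_twistCov h ε hε S.property

/-- `twistBTemp` lies over `twistCov` (definitional). [cite: MochizukiSemiAnbd2006, Def 3.5(ii) p.37] -/
theorem twistBTemp_comp_ι : twistBTemp h ε hε ⋙ ObjectProperty.ι _ = ObjectProperty.ι _ ⋙ twistCov h ε hε :=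
  rfl

/-- `twistBTemp` preserves finite limits. [cite: MochizukiSemiAnbd2006, §3 p.36] -/
theorem preservesLimitsOfShape_twistBTemp (J : Type) [SmallCategory J] [FinCategory J] :
    PreservesLimitsOfShape J (twistBTemp h ε hε) := by
  haveI := isTempered_isClosedUnderLimitsOfShape (𝒢 := 𝒢.double h) J
  haveI := CovObj.hasLimitsOfShape (𝒢 := 𝒢.double h) (J := J)
  haveI := preservesLimitsOfShape_twistCov h ε hε J
  haveI : PreservesLimitsOfShape J (twistBTemp h ε hε ⋙ ObjectProperty.ι _) := by
    rw [twistBTemp_comp_ι]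
    infer_instance
  exact preservesLimitsOfShape_of_reflects_of_preserves (twistBTemp h ε hε) (ObjectProperty.ι _)

/-- `twistBTemp` preserves countable colimits. [cite: MochizukiSemiAnbd2006, §3 p.36] -/
theorem preservesColimitsOfShape_twistBTemp (J : Type) [SmallCategory J] [CountableCategory J] :
    PreservesColimitsOfShape J (twistBTemp h ε hε) := by
  haveI := isTempered_isClosedUnderColimitsOfShape (𝒢 := 𝒢.double h) J
  haveI := CovObj.hasColimitsOfShape (𝒢 := 𝒢.double h) (J := J)
  haveI := preservesColimitsOfShape_twistCov h ε hε J
  haveI : PreservesColimitsOfShape J (twistBTemp h ε hε ⋙ ObjectProperty.ι _) := by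
    rw [twistBTemp_comp_ι]
    infer_instance
  exact preservesColimitsOfShape_of_reflects_of_preserves (twistBTemp h ε hε) (ObjectProperty.ι _)

/-! ### Through a chart: a morphism of connected temperoids and its representing homomorphism -/

/-- The twist through a chart: `B^temp(π₁^temp D) ⥤ B^temp(π₁^temp D)`, `c⁻¹ ⋙ twist ⋙ c`.
[cite: MochizukiSemiAnbd2006, Prop 3.2 p.35] -/
def twistChartPullback (cD : TemperedPiChart (𝒢.double h)) : BTemp cD.G ⥤ BTemp cD.G :=
  cD.equiv.inverse ⋙ twistBTemp h ε hε ⋙ cD.equiv.functor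

/-- The twist is a morphism of connected temperoids `B^temp(π₁^temp D) → B^temp(π₁^temp D)`
(Definition 3.1 (iii)). [cite: MochizukiSemiAnbd2006, Def 3.1(iii) p.33] -/
def twistTemperoidHom (cD : TemperedPiChart (𝒢.double h)) : TemperoidHom (BTemp cD.G) (BTemp cD.G) where
  pullback := twistChartPullback h ε hε cD
  preservesFiniteLimits := ⟨fun J _ _ => by
    haveI := preservesLimitsOfShape_twistBTemp h ε hε J
    unfold twistChartPullback
    infer_instance⟩
  preservesCountableColimits J _ _ := by
    haveI := preservesColimitsOfShape_twistBTemp h ε hε J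
    unfold twistChartPullback
    infer_instance

/-- **The twist homomorphism exists** (Proposition 3.2, `TemperoidHomEqRes_holds`): a continuous
`τ : π₁^temp(D) → π₁^temp(D)` with `B^temp(τ) ≅ c⁻¹ ⋙ twist ⋙ c`. [cite: MochizukiSemiAnbd2006, Prop 3.2 p.35] -/
theorem exists_twistHom (cD : TemperedPiChart (𝒢.double h)) :
    ∃ τ : cD.G →ₜ* cD.G, Nonempty (twistChartPullback h ε hε cD ≅ BTemp.res τ) := by
  haveI := cD.secondCountableTopology
  exact TemperoidHomEqRes_holds cD.G cD.G cD.isTempered cD.isTempered (twistTemperoidHom h ε hε cD)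

/-- **The twist fixes the verticial homomorphisms up to conjugation**: if `τ` represents the twist, then
for every verticial homomorphism `ψ` of `D` at `v`, `τ ∘ ψ` and `ψ` are conjugate in `π₁^temp(D)` — `τ` is
compatible with the identity morphism of `D` on verticial homomorphisms.
[cite: MochizukiSemiAnbd2006, Thm 3.7(i) p.40] -/
theorem twist_conj_verticial (cD : TemperedPiChart (𝒢.double h)) (τ : cD.G →ₜ* cD.G)
    (hτ : Nonempty (twistChartPullback h ε hε cD ≅ BTemp.res τ)) (v : (𝒢.double h).graph.Vertex)
    (ψ : (𝒢.double h).Gv v →ₜ* cD.G) (hψ : IsVerticialHom cD v ψ) :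
    ∃ g : cD.G, ∀ x, τ (ψ x) = g * ψ x * g⁻¹ := by
  obtain ⟨e⟩ := hτ
  obtain ⟨e'⟩ := hψ
  let s3 : (cD.equiv.inverse ⋙ twistBTemp h ε hε) ⋙ (cD.equiv.functor ⋙ BTemp.res ψ) ≅
      (cD.equiv.inverse ⋙ twistBTemp h ε hε) ⋙
        (cD.equiv.functor ⋙ (cD.equiv.inverse ⋙ ObjectProperty.ι _ ⋙ restrictV (𝒢.double h) v)) :=
    Functor.isoWhiskerLeft _ (Functor.isoWhiskerLeft _ e'.symm)
  let s4 : (cD.equiv.inverse ⋙ twistBTemp h ε hε) ⋙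
        (cD.equiv.functor ⋙ (cD.equiv.inverse ⋙ ObjectProperty.ι _ ⋙ restrictV (𝒢.double h) v)) ≅
      (cD.equiv.inverse ⋙ twistBTemp h ε hε) ⋙ (ObjectProperty.ι _ ⋙ restrictV (𝒢.double h) v) :=
    Functor.isoWhiskerLeft _ ((Functor.associator _ _ _).symm ≪≫
      Functor.isoWhiskerRight cD.equiv.unitIso.symm _ ≪≫ Functor.leftUnitor _)
  let s5 : (cD.equiv.inverse ⋙ twistBTemp h ε hε) ⋙ (ObjectProperty.ι _ ⋙ restrictV (𝒢.double h) v) ≅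
      cD.equiv.inverse ⋙ ObjectProperty.ι _ ⋙ restrictV (𝒢.double h) v :=
    Iso.refl _
  let η : BTemp.res (τ.comp ψ) ≅ BTemp.res ψ :=
    (BTemp.resComp τ ψ).symm ≪≫ Functor.isoWhiskerRight e.symm (BTemp.res ψ) ≪≫ s3 ≪≫ s4 ≪≫ s5 ≪≫ e'
  obtain ⟨g, hg, -⟩ := BTemp.exists_conj_of_natTrans cD.isTempered (τ.comp ψ) ψ η.hom
  refine ⟨g⁻¹, fun x => ?_⟩
  have hx := hg x
  change g * τ (ψ x) * g⁻¹ = ψ x at hx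
  calc τ (ψ x) = g⁻¹ * (g * τ (ψ x) * g⁻¹) * g := by group
    _ = g⁻¹ * ψ x * g⁻¹⁻¹ := by rw [hx]; group

/-- **The twist fixes the edge homomorphisms up to conjugation**: `τ ∘ ψ` and `ψ` are conjugate for
every edge homomorphism `ψ` of `D` — `τ` is compatible with the identity morphism of `D` on edge
homomorphisms as well. [cite: MochizukiSemiAnbd2006, Thm 3.7(iii) p.41] -/
theorem twist_conj_edge (cD : TemperedPiChart (𝒢.double h)) (τ : cD.G →ₜ* cD.G)
    (hτ : Nonempty (twistChartPullback h ε hε cD ≅ BTemp.res τ)) (e : (𝒢.double h).graph.Edge)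
    (ψ : (𝒢.double h).Ge e →ₜ* cD.G) (hψ : IsEdgeHom cD e ψ) :
    ∃ g : cD.G, ∀ x, τ (ψ x) = g * ψ x * g⁻¹ := by
  obtain ⟨e₀⟩ := hτ
  obtain ⟨e'⟩ := hψ
  let s3 : (cD.equiv.inverse ⋙ twistBTemp h ε hε) ⋙ (cD.equiv.functor ⋙ BTemp.res ψ) ≅
      (cD.equiv.inverse ⋙ twistBTemp h ε hε) ⋙
        (cD.equiv.functor ⋙ (cD.equiv.inverse ⋙ ObjectProperty.ι _ ⋙ restrictE (𝒢.double h) e)) :=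
    Functor.isoWhiskerLeft _ (Functor.isoWhiskerLeft _ e'.symm)
  let s4 : (cD.equiv.inverse ⋙ twistBTemp h ε hε) ⋙
        (cD.equiv.functor ⋙ (cD.equiv.inverse ⋙ ObjectProperty.ι _ ⋙ restrictE (𝒢.double h) e)) ≅
      (cD.equiv.inverse ⋙ twistBTemp h ε hε) ⋙ (ObjectProperty.ι _ ⋙ restrictE (𝒢.double h) e) :=
    Functor.isoWhiskerLeft _ ((Functor.associator _ _ _).symm ≪≫
      Functor.isoWhiskerRight cD.equiv.unitIso.symm _ ≪≫ Functor.leftUnitor _)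
  let s5 : (cD.equiv.inverse ⋙ twistBTemp h ε hε) ⋙ (ObjectProperty.ι _ ⋙ restrictE (𝒢.double h) e) ≅
      cD.equiv.inverse ⋙ ObjectProperty.ι _ ⋙ restrictE (𝒢.double h) e :=
    Iso.refl _
  let η : BTemp.res (τ.comp ψ) ≅ BTemp.res ψ :=
    (BTemp.resComp τ ψ).symm ≪≫ Functor.isoWhiskerRight e₀.symm (BTemp.res ψ) ≪≫ s3 ≪≫ s4 ≪≫ s5 ≪≫ e'
  obtain ⟨g, hg, -⟩ := BTemp.exists_conj_of_natTrans cD.isTempered (τ.comp ψ) ψ η.hom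
  refine ⟨g⁻¹, fun x => ?_⟩
  have hx := hg x
  change g * τ (ψ x) * g⁻¹ = ψ x at hx
  calc τ (ψ x) = g⁻¹ * (g * τ (ψ x) * g⁻¹) * g := by group
    _ = g⁻¹ * ψ x * g⁻¹⁻¹ := by rw [hx]; group

end ProfiniteSemiGraph

end Literature.AnabelianGeometry.SemiGraphs

end
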